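import Literature.LinearAlgebra.Matrix.RankNormalForm
import Mathlib.GroupTheory.GroupAction.Quotient
import Mathlib.Topology.Algebra.InfiniteSum.ENNReal
import Mathlib.Analysis.Normed.Group.InfiniteSum
import Mathlib.Analysis.Complex.Basic
import HarnessLib

/-!
# Orbits of `GL_n` on the non-zero singular `n × n` matrices over a field

Topic `LinearAlgebra/Matrix`; namespace `Literature.LinearAlgebra.Matrix`. Pure algebra (Mathlib and
`RankNormalForm`): the orbit structure of the two actions of `GL_n(F)` on the set
`T = {ξ ∈ M_n(F) : det ξ = 0, ξ ≠ 0}` of non-zero singular matrices — by right multiplication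
(`ξ ↦ ξ γ⁻¹`, type `SingR`) and by left multiplication (`ξ ↦ γ ξ`, type `SingL`) — as needed for
the unfolding of the singular theta terms of the Godement–Jacquet functional equation
(Godement–Jacquet (1972), §12: the terms `Σ_{rank ξ = r} Φ(h ξ g)` grouped by `GL_n(K)`-orbits).

* Block lemmas: `rankStdMatrixLast_mul_one_add_eq` (`E'_r (1 + X) = E'_r` for `X ∈ 𝔫_{n-r}`),
  `one_add_mul_rankStdMatrix_eq` (`(1 + X) E_r = E_r` for `X ∈ 𝔫_r`), and the parabolic shape of
  stabilisers `apply_eq_zero_of_rankStdMatrixLast_mul_eq`, `apply_eq_zero_of_mul_rankStdMatrix_eq`;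
* `SingR n F`, `SingL n F` with their `MulAction (GL (Fin n) F)` instances; the stabiliser subgroups
  `stabLast n F r = {γ : E'_r γ = E'_r}`, `stabFirst n F r = {γ : γ E_r = E_r}`;
* base points in rank normal form: `SingR.base ω = P E'_r` (`SingR.exists_base_eq`),
  `SingL.base ω = E_r Q`, lying in the orbit (`base_mem`), with **stabilisers
  `stabilizer (base ω) = stabLast / stabFirst`** (`SingR.stabilizer_base`, `SingL.stabilizer_base`);
* `tsum_orbit_eq_tsum_quotient` (orbit–stabiliser for `ℝ≥0∞`-sums) and the **orbit decompositions
  of sums** `SingR.tsum_eq_tsum_orbits`, `SingL.tsum_eq_tsum_orbits`: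
  `Σ_{ξ ∈ T} h(ξ) = Σ_ω Σ_{q ∈ GL_n/Stab} h(q.out • b_ω)`.
-/

noncomputable section

open Matrix MulAction
open scoped Classical ENNReal

namespace Literature.LinearAlgebra.Matrix

variable (n : ℕ) (F : Type*) [Field F]

/-! ### Block lemmas for the standard idempotents -/

section Block

variable {n F} {R : Type*} [CommRing R] {r : ℕ}

/-- **`E'_r (1 + X) = E'_r` for `X` in the upper-right block `𝔫_{n-r}`** (`X i j ≠ 0 ⇒ i < n - r ≤ j`):
the unipotent radical of `P_{n-r}` acts trivially on the right of `E'_r`. [folklore] -/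
theorem rankStdMatrixLast_mul_one_add_eq {X : Matrix (Fin n) (Fin n) R}
    (hX : ∀ i j, X i j ≠ 0 → (i : ℕ) < n - r ∧ n - r ≤ (j : ℕ)) :
    rankStdMatrixLast n r R * (1 + X) = rankStdMatrixLast n r R := by
  rw [mul_add, mul_one, add_eq_left]
  ext i j
  rw [rankStdMatrixLast, diagonal_mul, Matrix.zero_apply]
  by_cases hi : (i : ℕ) < n - r
  · rw [if_pos hi, zero_mul]
  · rw [if_neg hi, one_mul]
    by_contra h
    exact hi (hX i j h).1

/-- **`(1 + X) E_r = E_r` for `X` in the upper-right block `𝔫_r`** (`X i j ≠ 0 ⇒ i < r ≤ j`). [folklore] -/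
theorem one_add_mul_rankStdMatrix_eq {X : Matrix (Fin n) (Fin n) R}
    (hX : ∀ i j, X i j ≠ 0 → (i : ℕ) < r ∧ r ≤ (j : ℕ)) :
    (1 + X) * rankStdMatrix n r R = rankStdMatrix n r R := by
  rw [add_mul, one_mul, add_eq_left]
  ext i j
  rw [rankStdMatrix, mul_diagonal, Matrix.zero_apply]
  by_cases hj : (j : ℕ) < r
  · rw [if_pos hj, mul_one]
    by_contra h
    exact absurd hj (not_lt.2 (hX i j h).2)
  · rw [if_neg hj, mul_zero]

/-- **Elements of the right stabiliser of `E'_r` are block upper triangular for `P_{n-r}`**: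
if `E'_r γ = E'_r` then `γ i a = 0` whenever `a < n - r ≤ i`. [folklore] -/
theorem apply_eq_zero_of_rankStdMatrixLast_mul_eq {γ : Matrix (Fin n) (Fin n) R}
    (hγ : rankStdMatrixLast n r R * γ = rankStdMatrixLast n r R) {i a : Fin n}
    (hi : n - r ≤ (i : ℕ)) (ha : (a : ℕ) < n - r) : γ i a = 0 := by
  have h := congrFun (congrFun hγ i) a
  rw [rankStdMatrixLast, diagonal_mul, if_neg (not_lt.2 hi), one_mul, diagonal_apply] at h
  rw [h, if_neg]
  intro hia
  rw [hia] at hi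
  exact absurd ha (not_lt.2 hi)

/-- **Elements of the left stabiliser of `E_r` are block upper triangular for `P_r`**: if
`γ E_r = E_r` then `γ i a = 0` whenever `a < r ≤ i`. [folklore] -/
theorem apply_eq_zero_of_mul_rankStdMatrix_eq {γ : Matrix (Fin n) (Fin n) R}
    (hγ : γ * rankStdMatrix n r R = rankStdMatrix n r R) {i a : Fin n}
    (hi : r ≤ (i : ℕ)) (ha : (a : ℕ) < r) : γ i a = 0 := by
  have h := congrFun (congrFun hγ i) a
  rw [rankStdMatrix, mul_diagonal, if_pos ha, mul_one, diagonal_apply] at h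
  rw [h, if_neg]
  intro hia
  rw [hia] at hi
  exact absurd ha (not_lt.2 hi)

end Block

/-! ### The two actions of `GL_n` on non-zero singular matrices -/

/-- **Non-zero singular matrices, acted on by `GL_n` through `γ • ξ = ξ γ⁻¹`** (the right orbits
`ξ GL_n`). [folklore] -/
def SingR : Type _ := {ξ : Matrix (Fin n) (Fin n) F // ¬ IsUnit ξ ∧ ξ ≠ 0}

/-- **Non-zero singular matrices, acted on by `GL_n` through `γ • ξ = γ ξ`** (the left orbits
`GL_n ξ`). [folklore] -/
def SingL : Type _ := {ξ : Matrix (Fin n) (Fin n) F // ¬ IsUnit ξ ∧ ξ ≠ 0}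

variable {n F}

/-- Right multiplication by an invertible matrix preserves "singular and non-zero". [folklore] -/
theorem not_isUnit_and_ne_zero_mul_unit {ξ : Matrix (Fin n) (Fin n) F} (hξ : ¬ IsUnit ξ ∧ ξ ≠ 0)
    (γ : GL (Fin n) F) : ¬ IsUnit (ξ * (γ : Matrix (Fin n) (Fin n) F)) ∧ ξ * (γ : Matrix (Fin n) (Fin n) F) ≠ 0 := by
  constructor
  · intro h
    apply hξ.1
    have h' : IsUnit (ξ * (γ : Matrix (Fin n) (Fin n) F) * ((γ⁻¹ : GL (Fin n) F) : Matrix (Fin n) (Fin n) F)) :=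
      h.mul (Units.isUnit γ⁻¹)
    rwa [mul_assoc, ← Units.val_mul, mul_inv_cancel, Units.val_one, mul_one] at h'
  · intro h
    apply hξ.2
    have h' := congrArg (· * ((γ⁻¹ : GL (Fin n) F) : Matrix (Fin n) (Fin n) F)) h
    simp only [zero_mul] at h'
    rwa [mul_assoc, ← Units.val_mul, mul_inv_cancel, Units.val_one, mul_one] at h'

/-- Left multiplication by an invertible matrix preserves "singular and non-zero". [folklore] -/
theorem not_isUnit_and_ne_zero_unit_mul {ξ : Matrix (Fin n) (Fin n) F} (hξ : ¬ IsUnit ξ ∧ ξ ≠ 0)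
    (γ : GL (Fin n) F) : ¬ IsUnit ((γ : Matrix (Fin n) (Fin n) F) * ξ) ∧ (γ : Matrix (Fin n) (Fin n) F) * ξ ≠ 0 := by
  constructor
  · intro h
    apply hξ.1
    have h' : IsUnit (((γ⁻¹ : GL (Fin n) F) : Matrix (Fin n) (Fin n) F) * ((γ : Matrix (Fin n) (Fin n) F) * ξ)) :=
      (Units.isUnit γ⁻¹).mul h
    rwa [← mul_assoc, ← Units.val_mul, inv_mul_cancel, Units.val_one, one_mul] at h'
  · intro h
    apply hξ.2
    have h' := congrArg (((γ⁻¹ : GL (Fin n) F) : Matrix (Fin n) (Fin n) F) * ·) h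
    simp only [mul_zero] at h'
    rwa [← mul_assoc, ← Units.val_mul, inv_mul_cancel, Units.val_one, one_mul] at h'

/-- The action of `GL_n` on `SingR` by `γ • ξ = ξ γ⁻¹` (right orbits). [folklore] -/
instance : MulAction (GL (Fin n) F) (SingR n F) where
  smul γ ξ := ⟨ξ.1 * ((γ⁻¹ : GL (Fin n) F) : Matrix (Fin n) (Fin n) F), not_isUnit_and_ne_zero_mul_unit ξ.2 γ⁻¹⟩
  one_smul ξ := Subtype.ext (by
    change ξ.1 * (((1 : GL (Fin n) F)⁻¹ : GL (Fin n) F) : Matrix (Fin n) (Fin n) F) = ξ.1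
    rw [inv_one, Units.val_one, mul_one])
  mul_smul γ δ ξ := Subtype.ext (by
    change ξ.1 * (((γ * δ)⁻¹ : GL (Fin n) F) : Matrix (Fin n) (Fin n) F) =
      ξ.1 * ((δ⁻¹ : GL (Fin n) F) : Matrix (Fin n) (Fin n) F) * ((γ⁻¹ : GL (Fin n) F) : Matrix (Fin n) (Fin n) F)
    rw [_root_.mul_inv_rev, Units.val_mul, mul_assoc])

/-- The action of `GL_n` on `SingL` by `γ • ξ = γ ξ` (left orbits). [folklore] -/
instance : MulAction (GL (Fin n) F) (SingL n F) where
  smul γ ξ := ⟨((γ : GL (Fin n) F) : Matrix (Fin n) (Fin n) F) * ξ.1, not_isUnit_and_ne_zero_unit_mul ξ.2 γ⟩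
  one_smul ξ := Subtype.ext (by
    change (((1 : GL (Fin n) F)) : Matrix (Fin n) (Fin n) F) * ξ.1 = ξ.1
    rw [Units.val_one, one_mul])
  mul_smul γ δ ξ := Subtype.ext (by
    change (((γ * δ : GL (Fin n) F)) : Matrix (Fin n) (Fin n) F) * ξ.1 =
      ((γ : GL (Fin n) F) : Matrix (Fin n) (Fin n) F) * (((δ : GL (Fin n) F) : Matrix (Fin n) (Fin n) F) * ξ.1)
    rw [Units.val_mul, mul_assoc])

/-- The matrix of `γ • ξ` in `SingR`. [folklore] -/
theorem SingR.coe_smul (γ : GL (Fin n) F) (ξ : SingR n F) :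
    (γ • ξ).1 = ξ.1 * ((γ⁻¹ : GL (Fin n) F) : Matrix (Fin n) (Fin n) F) := rfl

/-- The matrix of `γ • ξ` in `SingL`. [folklore] -/
theorem SingL.coe_smul (γ : GL (Fin n) F) (ξ : SingL n F) :
    (γ • ξ).1 = ((γ : GL (Fin n) F) : Matrix (Fin n) (Fin n) F) * ξ.1 := rfl

/-! ### Stabilisers -/

variable (n F) in
/-- **The right stabiliser of `E'_r`**: `S'_r = {γ : E'_r γ = E'_r}` (matrices whose last `r` rows
are those of the identity). [folklore] -/
def stabLast (r : ℕ) : Subgroup (GL (Fin n) F) where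
  carrier := {γ | rankStdMatrixLast n r F * (γ : Matrix (Fin n) (Fin n) F) = rankStdMatrixLast n r F}
  one_mem' := by simp
  mul_mem' {a b} ha hb := by
    change rankStdMatrixLast n r F * ((a * b : GL (Fin n) F) : Matrix (Fin n) (Fin n) F) = _
    rw [Units.val_mul, ← mul_assoc, ha, hb]
  inv_mem' {a} ha := by
    change rankStdMatrixLast n r F * ((a⁻¹ : GL (Fin n) F) : Matrix (Fin n) (Fin n) F) = _
    conv_lhs => rw [← ha]
    rw [mul_assoc, ← Units.val_mul, mul_inv_cancel, Units.val_one, mul_one]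

/-- Membership in `stabLast`. [folklore] -/
theorem mem_stabLast_iff {r : ℕ} {γ : GL (Fin n) F} :
    γ ∈ stabLast n F r ↔ rankStdMatrixLast n r F * (γ : Matrix (Fin n) (Fin n) F) = rankStdMatrixLast n r F := Iff.rfl

variable (n F) in
/-- **The left stabiliser of `E_r`**: `S_r = {γ : γ E_r = E_r}` (matrices whose first `r` columns are
those of the identity). [folklore] -/
def stabFirst (r : ℕ) : Subgroup (GL (Fin n) F) where
  carrier := {γ | (γ : Matrix (Fin n) (Fin n) F) * rankStdMatrix n r F = rankStdMatrix n r F}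
  one_mem' := by simp
  mul_mem' {a b} ha hb := by
    change ((a * b : GL (Fin n) F) : Matrix (Fin n) (Fin n) F) * rankStdMatrix n r F = _
    rw [Units.val_mul, mul_assoc, hb, ha]
  inv_mem' {a} ha := by
    change ((a⁻¹ : GL (Fin n) F) : Matrix (Fin n) (Fin n) F) * rankStdMatrix n r F = _
    conv_lhs => rw [← ha]
    rw [← mul_assoc, ← Units.val_mul, inv_mul_cancel, Units.val_one, one_mul]

/-- Membership in `stabFirst`. [folklore] -/
theorem mem_stabFirst_iff {r : ℕ} {γ : GL (Fin n) F} :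
    γ ∈ stabFirst n F r ↔ (γ : Matrix (Fin n) (Fin n) F) * rankStdMatrix n r F = rankStdMatrix n r F := Iff.rfl

/-! ### Base points of the orbits in rank normal form -/

/-- **Every right orbit contains a matrix of the form `P E'_r`** (`r` the rank): from the normal
form `ξ = P E'_r Q`, `Q • ξ = ξ Q⁻¹ = P E'_r`. [folklore] -/
theorem SingR.exists_base (ω : orbitRel.Quotient (GL (Fin n) F) (SingR n F)) :
    ∃ b : SingR n F, b ∈ ω.orbit ∧ ∃ P : GL (Fin n) F,
      b.1 = (P : Matrix (Fin n) (Fin n) F) * rankStdMatrixLast n b.1.rank F := by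
  obtain ⟨P, Q, hξ⟩ := exists_units_eq_mul_rankStdMatrixLast_mul (ω.out).1
  refine ⟨Q • ω.out, ?_, P, ?_⟩
  · rw [orbitRel.Quotient.mem_orbit]
    calc Quotient.mk'' (Q • ω.out) = Quotient.mk'' ω.out := Quotient.sound' (mem_orbit _ Q)
      _ = ω := ω.out_eq'
  · have hval : (Q • ω.out).1 = (P : Matrix (Fin n) (Fin n) F) * rankStdMatrixLast n (ω.out).1.rank F := by
      rw [SingR.coe_smul]
      conv_lhs => rw [hξ]
      rw [mul_assoc, ← Units.val_mul, mul_inv_cancel, Units.val_one, mul_one]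
    have hrank : (Q • ω.out).1.rank = (ω.out).1.rank := by
      rw [SingR.coe_smul, rank_mul_eq_left_of_isUnit_det _ _ ((isUnit_iff_isUnit_det _).1 (Units.isUnit _))]
    rw [hrank]
    exact hval

/-- A chosen base point `P E'_r` of a right orbit. [folklore] -/
def SingR.base (ω : orbitRel.Quotient (GL (Fin n) F) (SingR n F)) : SingR n F :=
  (SingR.exists_base ω).choose

/-- The base point lies in its orbit. [folklore] -/
theorem SingR.base_mem (ω : orbitRel.Quotient (GL (Fin n) F) (SingR n F)) : SingR.base ω ∈ ω.orbit :=
  (SingR.exists_base ω).choose_spec.1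

/-- The base point is `P E'_r` for some invertible `P`, `r` its rank. [folklore] -/
theorem SingR.exists_base_eq (ω : orbitRel.Quotient (GL (Fin n) F) (SingR n F)) :
    ∃ P : GL (Fin n) F, (SingR.base ω).1 = (P : Matrix (Fin n) (Fin n) F) * rankStdMatrixLast n (SingR.base ω).1.rank F :=
  (SingR.exists_base ω).choose_spec.2

/-- **The stabiliser of the base point of a right orbit is `S'_r`** (`r` the rank of the orbit):
`P E'_r γ⁻¹ = P E'_r ⇔ E'_r γ = E'_r`. [folklore] -/
theorem SingR.stabilizer_base (ω : orbitRel.Quotient (GL (Fin n) F) (SingR n F)) :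
    stabilizer (GL (Fin n) F) (SingR.base ω) = stabLast n F (SingR.base ω).1.rank := by
  obtain ⟨P, hP⟩ := SingR.exists_base_eq ω
  ext γ
  rw [mem_stabilizer_iff, mem_stabLast_iff]
  constructor
  · intro h
    have h' := congrArg Subtype.val h
    rw [SingR.coe_smul, hP, mul_assoc] at h'
    have h'' : rankStdMatrixLast n (SingR.base ω).1.rank F * ((γ⁻¹ : GL (Fin n) F) : Matrix (Fin n) (Fin n) F) =
        rankStdMatrixLast n (SingR.base ω).1.rank F := by
      have := congrArg (((P⁻¹ : GL (Fin n) F) : Matrix (Fin n) (Fin n) F) * ·) h'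
      simpa only [← mul_assoc, ← Units.val_mul, inv_mul_cancel, Units.val_one, one_mul] using this
    have := congrArg (· * ((γ : GL (Fin n) F) : Matrix (Fin n) (Fin n) F)) h''
    simpa only [mul_assoc, ← Units.val_mul, inv_mul_cancel, Units.val_one, mul_one] using this.symm
  · intro h
    refine Subtype.ext ?_
    rw [SingR.coe_smul, hP, mul_assoc]
    congr 1
    have := congrArg (· * ((γ⁻¹ : GL (Fin n) F) : Matrix (Fin n) (Fin n) F)) h
    simpa only [mul_assoc, ← Units.val_mul, mul_inv_cancel, Units.val_one, mul_one] using this.symm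

/-- **Every left orbit contains a matrix of the form `E_r Q`** (`r` the rank): from the normal form
`ξ = P E_r Q`, `P⁻¹ • ξ = E_r Q`. [folklore] -/
theorem SingL.exists_base (ω : orbitRel.Quotient (GL (Fin n) F) (SingL n F)) :
    ∃ b : SingL n F, b ∈ ω.orbit ∧ ∃ Q : GL (Fin n) F,
      b.1 = rankStdMatrix n b.1.rank F * (Q : Matrix (Fin n) (Fin n) F) := by
  obtain ⟨P, Q, hξ⟩ := exists_units_eq_mul_rankStdMatrix_mul (ω.out).1
  refine ⟨P⁻¹ • ω.out, ?_, Q, ?_⟩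
  · rw [orbitRel.Quotient.mem_orbit]
    calc Quotient.mk'' (P⁻¹ • ω.out) = Quotient.mk'' ω.out := Quotient.sound' (mem_orbit _ P⁻¹)
      _ = ω := ω.out_eq'
  · have hval : (P⁻¹ • ω.out).1 = rankStdMatrix n (ω.out).1.rank F * (Q : Matrix (Fin n) (Fin n) F) := by
      rw [SingL.coe_smul]
      conv_lhs => rw [hξ]
      rw [← mul_assoc, ← mul_assoc, ← Units.val_mul, inv_mul_cancel, Units.val_one, one_mul]
    have hrank : (P⁻¹ • ω.out).1.rank = (ω.out).1.rank := by
      rw [SingL.coe_smul, rank_mul_eq_right_of_isUnit_det _ _ ((isUnit_iff_isUnit_det _).1 (Units.isUnit _))]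
    rw [hrank]
    exact hval

/-- A chosen base point `E_r Q` of a left orbit. [folklore] -/
def SingL.base (ω : orbitRel.Quotient (GL (Fin n) F) (SingL n F)) : SingL n F :=
  (SingL.exists_base ω).choose

/-- The base point lies in its orbit. [folklore] -/
theorem SingL.base_mem (ω : orbitRel.Quotient (GL (Fin n) F) (SingL n F)) : SingL.base ω ∈ ω.orbit :=
  (SingL.exists_base ω).choose_spec.1

/-- The base point is `E_r Q` for some invertible `Q`. [folklore] -/
theorem SingL.exists_base_eq (ω : orbitRel.Quotient (GL (Fin n) F) (SingL n F)) :
    ∃ Q : GL (Fin n) F, (SingL.base ω).1 = rankStdMatrix n (SingL.base ω).1.rank F * (Q : Matrix (Fin n) (Fin n) F) :=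
  (SingL.exists_base ω).choose_spec.2

/-- **The stabiliser of the base point of a left orbit is `S_r`**: `γ E_r Q = E_r Q ⇔ γ E_r = E_r`.
[folklore] -/
theorem SingL.stabilizer_base (ω : orbitRel.Quotient (GL (Fin n) F) (SingL n F)) :
    stabilizer (GL (Fin n) F) (SingL.base ω) = stabFirst n F (SingL.base ω).1.rank := by
  obtain ⟨Q, hQ⟩ := SingL.exists_base_eq ω
  ext γ
  rw [mem_stabilizer_iff, mem_stabFirst_iff]
  constructor
  · intro h
    have h' := congrArg Subtype.val h
    rw [SingL.coe_smul, hQ, ← mul_assoc] at h'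
    have := congrArg (· * ((Q⁻¹ : GL (Fin n) F) : Matrix (Fin n) (Fin n) F)) h'
    simpa only [mul_assoc, ← Units.val_mul, mul_inv_cancel, Units.val_one, mul_one] using this
  · intro h
    refine Subtype.ext ?_
    rw [SingL.coe_smul, hQ, ← mul_assoc, h]

/-! ### Reindexing sums over singular matrices by orbits and cosets of the stabiliser -/

/-- The orbit of a class is the orbit of its base point (`SingR`). [folklore] -/
theorem SingR.orbit_eq (ω : orbitRel.Quotient (GL (Fin n) F) (SingR n F)) :
    ω.orbit = orbit (GL (Fin n) F) (SingR.base ω) := by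
  have h := SingR.base_mem ω
  rw [orbitRel.Quotient.mem_orbit] at h
  conv_lhs => rw [← h, orbitRel.Quotient.orbit_mk]

/-- The orbit of a class is the orbit of its base point (`SingL`). [folklore] -/
theorem SingL.orbit_eq (ω : orbitRel.Quotient (GL (Fin n) F) (SingL n F)) :
    ω.orbit = orbit (GL (Fin n) F) (SingL.base ω) := by
  have h := SingL.base_mem ω
  rw [orbitRel.Quotient.mem_orbit] at h
  conv_lhs => rw [← h, orbitRel.Quotient.orbit_mk]

/-- **Sums over an orbit as sums over cosets of the stabiliser**:
`Σ_{ξ ∈ G b} h(ξ) = Σ_{q ∈ G/Stab(b)} h(q.out • b)` (`ℝ≥0∞`-valued; any group action). [folklore] -/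
theorem tsum_orbit_eq_tsum_quotient {G X : Type*} [Group G] [MulAction G X] (b : X) (h : X → ℝ≥0∞) :
    ∑' ξ : orbit G b, h ξ = ∑' q : G ⧸ stabilizer G b, h (q.out • b) := by
  rw [← (orbitEquivQuotientStabilizer G b).symm.tsum_eq]
  refine tsum_congr fun q => ?_
  conv_lhs => rw [← q.out_eq']
  rfl

/-- **Orbit decomposition of sums over non-zero singular matrices (right orbits)**:
`Σ_ξ h(ξ) = Σ_ω Σ_{q ∈ GL_n/Stab} h(b_ω q.out⁻¹)` for `h ≥ 0`, `b_ω = P_ω E'_{r(ω)}` the base points.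
[folklore] -/
theorem SingR.tsum_eq_tsum_orbits (h : SingR n F → ℝ≥0∞) :
    ∑' ξ : SingR n F, h ξ =
      ∑' ω : orbitRel.Quotient (GL (Fin n) F) (SingR n F),
        ∑' q : GL (Fin n) F ⧸ stabilizer (GL (Fin n) F) (SingR.base ω), h (q.out • SingR.base ω) := by
  rw [← (selfEquivSigmaOrbits' (GL (Fin n) F) (SingR n F)).symm.tsum_eq, ENNReal.tsum_sigma']
  refine tsum_congr fun ω => ?_
  rw [← tsum_orbit_eq_tsum_quotient (SingR.base ω) h,
    ← tsum_congr_set_coe (fun ξ : SingR n F => h ξ) (SingR.orbit_eq ω)]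
  rfl

/-- **Orbit decomposition of sums over non-zero singular matrices (left orbits).** [folklore] -/
theorem SingL.tsum_eq_tsum_orbits (h : SingL n F → ℝ≥0∞) :
    ∑' ξ : SingL n F, h ξ =
      ∑' ω : orbitRel.Quotient (GL (Fin n) F) (SingL n F),
        ∑' q : GL (Fin n) F ⧸ stabilizer (GL (Fin n) F) (SingL.base ω), h (q.out • SingL.base ω) := by
  rw [← (selfEquivSigmaOrbits' (GL (Fin n) F) (SingL n F)).symm.tsum_eq, ENNReal.tsum_sigma']
  refine tsum_congr fun ω => ?_
  rw [← tsum_orbit_eq_tsum_quotient (SingL.base ω) h,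
    ← tsum_congr_set_coe (fun ξ : SingL n F => h ξ) (SingL.orbit_eq ω)]
  rfl

end Literature.LinearAlgebra.Matrix
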